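import Literature.NumberTheory.PAdicHodge.DeRhamTrivialQuotient
import Literature.NumberTheory.PAdicHodge.BdRCyclotomic
import Literature.NumberTheory.PAdicHodge.FontaineDpstUnconditional
import Literature.NumberTheory.PAdicHodge.HodgeTateUnramifiedWeights
import HarnessLib

/-!
# Extensions of the trivial representation by `ℚ_p(1)^d` are de Rham (Bloch–Kato 1990, Example 3.9:
# `H¹_g(K, ℚ_p(1)) = H¹(K, ℚ_p(1))`) — the Tate-curve sector of "`V_pE` is de Rham"

Topic `NumberTheory/PAdicHodge`; theorems only (no definition, no named fact, no instance).

For a `p`-adic field `F` (any `ℚ_p`-algebra structure on it) and Fontaine's `B_dR(F)` (the tree's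
`bdRPeriodRingData hp`): let `ρ` be a continuous representation of `Γ_F` on a finite-dimensional `ℚ_p`-vector
space `M` (module topology) and `N ≤ M` a subspace on which `Γ_F` acts through the cyclotomic character
(`ρ σ n = χ(σ) n`) and on whose quotient it acts trivially (`ρ σ m − m ∈ N`). Then

* `isDeRham_subrepresentation_of_cyclotomic` — `ρ|_N ≅ ℚ_p(1)^d` is de Rham, with the invariants
  `t⁻¹ ⊗ n` (`t = log[ε]`, `χ(σ)·σ(t⁻¹) = t⁻¹`, tree `bdRPeriodRingData_period`);
* `filD_zero_subrepresentation_of_cyclotomic` — `Fil⁰ D_dR(ρ|_N) = 0` (`t⁻¹ ∉ B_dR⁺`, tree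
  `tFrac_inv_mem_fil_iff`; coordinates along a basis detect the filtration,
  `mem_fil_of_sum_tmul_mem_filTensor`);
* **`isDeRham_of_cyclotomic_sub_of_trivial_quotient` — `ρ` is de Rham**, by the dévissage
  `isDeRham_of_subrepresentation_of_trivial_quotient` (Kato II Prop. 1.2.3: `H¹(F, N) → H¹(F, B_dR⁺ ⊗ N)`
  vanishes since `D⁰_dR(N) = 0`). This is Bloch–Kato's Example 3.9, "`H¹_g(K, ℚ_p(1)) = H¹(K, ℚ_p(1))`:
  every extension `0 → ℚ_p(1) → V → ℚ_p → 0` is de Rham", for `d` copies at once.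

Motivation (BSD cell `bsd-wall`, crux K★ `stmt-BirchSwinnertonDyer-22226`, stub hDR
`isDeRham_restrictedRationalTateRep`): for an elliptic curve with split multiplicative reduction over `F`
(Tate curve `E_q`), `0 → ℚ_p(1) → V_pE → ℚ_p → 0` (Silverman, *ATAEC* V.§5–6), so `V_pE` is de Rham by this
file; potentially multiplicative reduction follows by the tree's de Rham descent. No `B_cris`, no Tate-curve
periods `log[q̃]` are needed.

## References

* [BlochKato1990] S. Bloch, K. Kato, *L-functions and Tamagawa numbers of motives* (1990), Example 3.9 (p. 359),
  Cor. 3.8.4.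
* [Kato1993LNM1553] K. Kato, LNM 1553 (1993), Ch. II Prop. 1.2.3.
* [FontaineAsterisque223III] J.-M. Fontaine, Astérisque 223 (1994), Exp. II §1.5.5 (`σ t = χ(σ) t`), Exp. III §1.5.
-/

noncomputable section

open scoped TensorProduct
open TensorProduct Field ValuativeRel

namespace Literature.NumberTheory.PAdicHodge

open Literature.NumberTheory.GaloisRepresentations
open Literature.NumberTheory.GaloisRepresentations.IsNonarchimedeanLocalField

-- Mathlib's own global value; see the implementation note of `PAdicHodgeProofs.lean`.
set_option maxSynthPendingDepth 3

variable {F : Type} [Field F] [ValuativeRel F] [TopologicalSpace F] [IsNonarchimedeanLocalField F]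
  [CharZero F] {p : ℕ} [Fact p.Prime] [Fact (¬ IsUnit (p : integerC F))]
  [IsAdicComplete (Ideal.span {(p : integerC F)}) (integerC F)] (hp : valuation F p < 1) [Algebra ℚ_[p] F]
  {M : Type} [AddCommGroup M] [Module ℚ_[p] M] [TopologicalSpace M]

omit [ValuativeRel F] [TopologicalSpace F] [IsNonarchimedeanLocalField F] [CharZero F]
  [Fact (¬ IsUnit (p : integerC F))] [IsAdicComplete (Ideal.span {(p : integerC F)}) (integerC F)]
  [Algebra ℚ_[p] F] in
/-- A subspace on which `Γ_F` acts through a scalar character is stable. [folklore] -/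
private theorem stable_of_cyclotomic (ρ : GaloisRep F ℚ_[p] M) (N : Submodule ℚ_[p] M)
    (hχ : ∀ (g : absoluteGaloisGroup F) (n : M), n ∈ N →
      ρ g n = (((GaloisRep.cyclotomicCharacter F p g : ℤ_[p]ˣ) : ℤ_[p]) : ℚ_[p]) • n) :
    ∀ g : absoluteGaloisGroup F, N ≤ N.comap (ρ g) := by
  intro g n hn
  change ρ g n ∈ N
  rw [hχ g n hn]
  exact N.smul_mem _ hn

section Period

/-! In this section `B_dR⁺(F)` is known to be a domain (`isDomain_bDeRhamPlus`), so that `t⁻¹ ∈ B_dR(F)` can be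
named in statements; the instance is discharged inside the proofs of the main theorems below. -/

variable [IsDomain (BDeRhamPlus (integerC F) p)]

/-- **The invariants `t⁻¹ ⊗ n ∈ D_dR(ρ|_N)`** for a subspace `N` on which `Γ_F` acts through `χ_cyclo`:
`σ(t⁻¹ ⊗ n) = χ(σ)⁻¹t⁻¹ ⊗ χ(σ) n = t⁻¹ ⊗ n`. [cite: FontaineAsterisque223III, Exp. II §1.5.5 and Exp. III §1.5] -/
theorem tFrac_inv_tmul_mem_D (ρ : GaloisRep F ℚ_[p] M) (N : Submodule ℚ_[p] M)
    (hχ : ∀ (g : absoluteGaloisGroup F) (n : M), n ∈ N →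
      ρ g n = (((GaloisRep.cyclotomicCharacter F p g : ℤ_[p]ˣ) : ℤ_[p]) : ℚ_[p]) • n) (n : N) :
    (show (bdRPeriodRingData (F := F) (p := p) hp).B from ((tFrac : FracBdR F p)⁻¹ : FracBdR F p)) ⊗ₜ[ℚ_[p]] n ∈
      (bdRPeriodRingData (F := F) (p := p) hp).D (ρ.subrepresentation N (stable_of_cyclotomic ρ N hχ)) := by
  set 𝔅 := bdRPeriodRingData (F := F) (p := p) hp with h𝔅
  set s : 𝔅.B := (show 𝔅.B from ((tFrac : FracBdR F p)⁻¹ : FracBdR F p)) with hs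
  rw [PeriodRingData.mem_D_iff]
  intro σ
  have hper : algebraMap ℚ_[p] 𝔅.B (((GaloisRep.cyclotomicCharacter F p σ : ℤ_[p]ˣ) : ℤ_[p]) : ℚ_[p]) * σ • s = s := by
    have h := bdRPeriodRingData_period hp (algebraMap_padic_eq_padicRingHom hp) σ
    rw [PeriodRingData.chi, cyclotomicRepQp_apply, mul_one] at h
    exact h
  have hact : ρ.subrepresentation N (stable_of_cyclotomic ρ N hχ) σ n =
      (((GaloisRep.cyclotomicCharacter F p σ : ℤ_[p]ˣ) : ℤ_[p]) : ℚ_[p]) • n :=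
    Subtype.ext (by rw [ContinuousRep.subrepresentation_apply_coe, Submodule.coe_smul, hχ σ n n.2])
  rw [PeriodRingData.tensorRep_apply_tmul, hact, tmul_smul, smul_tmul', Algebra.smul_def, hper]

omit [TopologicalSpace M] in
/-- The `t⁻¹ ⊗ n_j` along a basis `(n_j)` of `N` are `F`-linearly independent in `B_dR ⊗ N` (they are a
`B_dR`-basis). [cite: FontaineAsterisque223III, Exp. III §1.5] -/
private theorem linearIndependent_tFrac_inv_tmul (N : Submodule ℚ_[p] M) {ι : Type} [Fintype ι]
    (nb : Module.Basis ι ℚ_[p] N) :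
    LinearIndependent F (fun j =>
      (show (bdRPeriodRingData (F := F) (p := p) hp).B from ((tFrac : FracBdR F p)⁻¹ : FracBdR F p)) ⊗ₜ[ℚ_[p]]
        (nb j)) := by
  set 𝔅 := bdRPeriodRingData (F := F) (p := p) hp with h𝔅
  set s : 𝔅.B := (show 𝔅.B from ((tFrac : FracBdR F p)⁻¹ : FracBdR F p)) with hs
  have hunit : IsUnit s := by
    have h : IsUnit ((tFrac : FracBdR F p)⁻¹ : FracBdR F p) :=
      isUnit_iff_ne_zero.mpr (inv_ne_zero (tFrac_ne_zero (surjective_fontaineTheta_integerC hp)))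
    exact h
  have hB : LinearIndependent 𝔅.B (fun j => (1 : 𝔅.B) ⊗ₜ[ℚ_[p]] (nb j)) := by
    have h := (Algebra.TensorProduct.basis 𝔅.B nb).linearIndependent
    have hfun : ⇑(Algebra.TensorProduct.basis 𝔅.B nb) = fun j => (1 : 𝔅.B) ⊗ₜ[ℚ_[p]] (nb j) :=
      funext fun j => Algebra.TensorProduct.basis_apply nb j
    rwa [hfun] at h
  have hB' : LinearIndependent 𝔅.B (fun j => s ⊗ₜ[ℚ_[p]] (nb j)) := by
    have h := hB.units_smul (fun _ => hunit.unit)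
    have hfun : ((fun _ : ι => hunit.unit) • fun j => (1 : 𝔅.B) ⊗ₜ[ℚ_[p]] (nb j)) =
        fun j => s ⊗ₜ[ℚ_[p]] (nb j) := by
      funext j
      rw [Pi.smul_apply', Units.smul_def, IsUnit.unit_spec, smul_tmul', smul_eq_mul, mul_one]
    rwa [hfun] at h
  refine hB'.restrict_scalars ?_
  intro r r' hrr'
  have h' : algebraMap F 𝔅.B r = algebraMap F 𝔅.B r' := by
    simpa only [Algebra.smul_def, mul_one] using hrr'
  exact (algebraMap F 𝔅.B).injective h'

end Period

variable [IsTopologicalAddGroup M] [ContinuousSMul ℚ_[p] M] [Module.Finite ℚ_[p] M] [IsModuleTopology ℚ_[p] M]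

omit [IsTopologicalAddGroup M] [ContinuousSMul ℚ_[p] M] [IsModuleTopology ℚ_[p] M] in
/-- **`ρ|_N ≅ ℚ_p(1)^d` is de Rham**: `dim_F D_dR(ρ|_N) = dim N`, the `t⁻¹ ⊗ n_j` being independent invariants.
[cite: FontaineAsterisque223III, Exp. III §1.5] [cite: BlochKato1990, Example 3.9] -/
theorem isDeRham_subrepresentation_of_cyclotomic (ρ : GaloisRep F ℚ_[p] M) (N : Submodule ℚ_[p] M)
    (hχ : ∀ (g : absoluteGaloisGroup F) (n : M), n ∈ N →
      ρ g n = (((GaloisRep.cyclotomicCharacter F p g : ℤ_[p]ˣ) : ℤ_[p]) : ℚ_[p]) • n) :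
    GaloisRep.IsDeRham (bdRPeriodRingData (F := F) (p := p) hp)
      (ρ.subrepresentation N (stable_of_cyclotomic ρ N hχ)) := by
  classical
  haveI : IsDomain (BDeRhamPlus (integerC F) p) :=
    isDomain_bDeRhamPlus (F := F) (p := p) (surjective_fontaineTheta_integerC hp)
  set 𝔅 := bdRPeriodRingData (F := F) (p := p) hp with h𝔅
  set ρN := ρ.subrepresentation N (stable_of_cyclotomic ρ N hχ) with hρN
  set s : 𝔅.B := (show 𝔅.B from ((tFrac : FracBdR F p)⁻¹ : FracBdR F p)) with hs
  let nb := Module.finBasis ℚ_[p] N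
  haveI : Module.Finite F (𝔅.D ρN) := 𝔅.finite_D ρN
  have hspan : Submodule.span F (Set.range fun j => s ⊗ₜ[ℚ_[p]] (nb j)) ≤ 𝔅.D ρN := by
    refine Submodule.span_le.mpr ?_
    rintro _ ⟨j, rfl⟩
    exact tFrac_inv_tmul_mem_D hp ρ N hχ (nb j)
  refine le_antisymm (𝔅.finrank_D_le_holds ρN) ?_
  calc Module.finrank ℚ_[p] N = Fintype.card (Fin (Module.finrank ℚ_[p] N)) := (Fintype.card_fin _).symm
    _ = Module.finrank F (Submodule.span F (Set.range fun j => s ⊗ₜ[ℚ_[p]] (nb j))) :=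
        (finrank_span_eq_card (linearIndependent_tFrac_inv_tmul hp N nb)).symm
    _ ≤ Module.finrank F (𝔅.D ρN) := Submodule.finrank_mono hspan

omit [IsTopologicalAddGroup M] [ContinuousSMul ℚ_[p] M] [IsModuleTopology ℚ_[p] M] in
/-- **`Fil⁰ D_dR(ρ|_N) = 0`** for `ρ|_N ≅ ℚ_p(1)^d`: `D_dR(ρ|_N) = ⊕_j F · (t⁻¹ ⊗ n_j)` and `t⁻¹ ∉ B_dR⁺`
(Hodge–Tate weight `-1`). [cite: FontaineAsterisque223III, Exp. II §1.5.5 and Exp. III §1.5] -/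
theorem filD_zero_subrepresentation_of_cyclotomic (ρ : GaloisRep F ℚ_[p] M) (N : Submodule ℚ_[p] M)
    (hχ : ∀ (g : absoluteGaloisGroup F) (n : M), n ∈ N →
      ρ g n = (((GaloisRep.cyclotomicCharacter F p g : ℤ_[p]ˣ) : ℤ_[p]) : ℚ_[p]) • n) :
    (bdRPeriodRingData (F := F) (p := p) hp).filD (ρ.subrepresentation N (stable_of_cyclotomic ρ N hχ)) 0 = ⊥ := by
  classical
  have hF := surjective_fontaineTheta_integerC (F := F) (p := p) hp
  haveI : IsDomain (BDeRhamPlus (integerC F) p) := isDomain_bDeRhamPlus (F := F) (p := p) hF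
  set 𝔅 := bdRPeriodRingData (F := F) (p := p) hp with h𝔅
  set ρN := ρ.subrepresentation N (stable_of_cyclotomic ρ N hχ) with hρN
  set s : 𝔅.B := (show 𝔅.B from ((tFrac : FracBdR F p)⁻¹ : FracBdR F p)) with hs
  have hsfil : s ∉ 𝔅.fil 0 := fun h => by
    have h' := (tFrac_inv_mem_fil_iff hF hp 0).mp h
    omega
  let nb := Module.finBasis ℚ_[p] N
  haveI : Module.Finite F (𝔅.D ρN) := 𝔅.finite_D ρN
  have hli := linearIndependent_tFrac_inv_tmul hp N nb
  have hspan : Submodule.span F (Set.range fun j => s ⊗ₜ[ℚ_[p]] (nb j)) ≤ 𝔅.D ρN := by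
    refine Submodule.span_le.mpr ?_
    rintro _ ⟨j, rfl⟩
    exact tFrac_inv_tmul_mem_D hp ρ N hχ (nb j)
  have hDeq : Submodule.span F (Set.range fun j => s ⊗ₜ[ℚ_[p]] (nb j)) = 𝔅.D ρN := by
    refine Submodule.eq_of_le_of_finrank_eq hspan ?_
    rw [finrank_span_eq_card hli, Fintype.card_fin]
    exact (isDeRham_subrepresentation_of_cyclotomic hp ρ N hχ).symm
  rw [eq_bot_iff]
  intro x hx
  rw [PeriodRingData.mem_filD_iff] at hx
  have hxD : (x : 𝔅.B ⊗[ℚ_[p]] N) ∈ Submodule.span F (Set.range fun j => s ⊗ₜ[ℚ_[p]] (nb j)) := by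
    rw [hDeq]; exact x.2
  obtain ⟨c, hc⟩ := (Submodule.mem_span_range_iff_exists_fun F).mp hxD
  have hsum : (x : 𝔅.B ⊗[ℚ_[p]] N) = ∑ j, (c j • s) ⊗ₜ[ℚ_[p]] (nb j) := by
    rw [← hc]
    exact Finset.sum_congr rfl fun j _ => by rw [smul_tmul']
  have hcoord : ∀ j, c j • s ∈ 𝔅.fil 0 := by
    have hx' : ∑ j, (c j • s) ⊗ₜ[ℚ_[p]] (nb j) ∈ 𝔅.filTensor N 0 := by rw [← hsum]; exact hx
    exact 𝔅.mem_fil_of_sum_tmul_mem_filTensor nb hx'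
  have hc0 : ∀ j, c j = 0 := fun j => by
    by_contra hj
    apply hsfil
    have h := (𝔅.fil 0).smul_mem (c j)⁻¹ (hcoord j)
    rwa [inv_smul_smul₀ hj] at h
  rw [Submodule.mem_bot]
  apply Subtype.ext
  rw [hsum, Submodule.coe_zero]
  exact Finset.sum_eq_zero fun j _ => by rw [hc0 j, zero_smul, zero_tmul]

/-- **Bloch–Kato 1990, Example 3.9 (`H¹_g(K, ℚ_p(1)) = H¹(K, ℚ_p(1))`), as a de Rham statement**: a continuous
finite-dimensional `ℚ_p`-representation of `Γ_F` with a subspace `N` on which `Γ_F` acts through `χ_cyclo` and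
with trivial action on `M ⧸ N` — an extension of `ℚ_p^k` by `ℚ_p(1)^d` — is de Rham (for `B_dR(F)`, every `p`-adic
field `F`, every `ℚ_p`-algebra structure). The Tate-curve sector of "`V_pE` is de Rham".
[cite: BlochKato1990, Example 3.9 and Cor. 3.8.4] [cite: Kato1993LNM1553, Ch. II Prop. 1.2.3] -/
theorem isDeRham_of_cyclotomic_sub_of_trivial_quotient (ρ : GaloisRep F ℚ_[p] M) (N : Submodule ℚ_[p] M)
    (hχ : ∀ (g : absoluteGaloisGroup F) (n : M), n ∈ N →
      ρ g n = (((GaloisRep.cyclotomicCharacter F p g : ℤ_[p]ˣ) : ℤ_[p]) : ℚ_[p]) • n)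
    (htriv : ∀ (g : absoluteGaloisGroup F) (m : M), ρ g m - m ∈ N) :
    GaloisRep.IsDeRham (bdRPeriodRingData (F := F) (p := p) hp) ρ :=
  isDeRham_of_subrepresentation_of_trivial_quotient hp ρ N (stable_of_cyclotomic ρ N hχ) htriv
    (isDeRham_subrepresentation_of_cyclotomic hp ρ N hχ) (filD_zero_subrepresentation_of_cyclotomic hp ρ N hχ)

end Literature.NumberTheory.PAdicHodge

end
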